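import Mathlib
import HarnessLib
import Literature.Analysis.Calculus.SphereAngularRigidity
import Summits.NavierStokesRegularity.NavierStokesRegularity.Theorems.UnthreadedDoorKinematicShadowZonalMeridian
import Summits.NavierStokesRegularity.NavierStokesRegularity.Theorems.UnthreadedDoorKinematicShadowZonalLawComponents
import Summits.NavierStokesRegularity.NavierStokesRegularity.Theorems.UnthreadedDoorKinematicShadowTransportNoGo
import Summits.NavierStokesRegularity.NavierStokesRegularity.Theorems.AxisTwistDoorAveragedConeLiouvilleMeridianLaplacian

/-!
# Route `UnthreadedDoor`, crux `PoloidalLiouville` (stmt-NavierStokesRegularity-1222), WALL W1 — crux idea «kinematic-shadow»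
# (ns-idea-15, `Cruxes/PoloidalLiouville/KinematicShadowSketch.lean` v1.2): ★ THE ZONAL SUB-RUNG A_z BY NAME —
# `KinematicShadow.HomogeneousZonalToroidalNeverSteady`

ARM A (ns-exp-scalarLiouville g5), director KEY-NS 2026-08-29 02:19Z (2) (re-scoped with ns-wall-crit-1 / ns-qj-p1: "A_z by name").
**Theorem** (`homogeneousZonalToroidalNeverSteady`, the sketch Prop VERBATIM with `SteadyKinematicLawOn` unfolded): no `C¹`
divergence-free field `u` satisfies the steady kinematic law `∇(u·∇Z − ΔZ) × (x − x₀) = ∇(u·(x − x₀)) × ∇Z` on an exterior shell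
`{R < ‖x − x₀‖}` for a zonal 0-homogeneous potential `Z(x) = t(⟪x − x₀, e⟫/‖x − x₀‖)` with `t ∈ C³`, `t′ > 0` on `[−1, 1]`.

Proof (ns-qj-p1's pointwise route, NOTE kinematic-shadow-zonal-pointwise / BLUEPRINT R1–R7; critic V20):  the law's three frame
components (`zonalLaw_components`) give rotation invariance of `u_r`, `u_θ` and the `θ`-identity; `div u = 0` in the frame with
`∂_φ u_φ = 0` (`azimuthal_strain_eq`) gives the meridian identity (†) `L′ = r sin θ (h u_r − h′ u_θ)` (`zonal_dagger`,
`h = t′∘cos`, `L(θ) = ΔZ(x₀ + e_r(θ))`); hence `W := h · r sin θ · u_θ` solves the transport equation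
`∂_θ W + (h′/h) r ∂_r W = −L′` on `(R,∞) × (0,π)` (`zonal_transport`) and vanishes at the poles locally uniformly in `r`
(`zonal_boundary_decay`); ns-qj-p1's `transport_noGo` forces `L(0) = L(π)`, contradicting the pole values `L(0) = −2t′(1) < 0 <
2t′(−1) = L(π)` (`laplacian_zonal_north/south`).

HONEST LABEL: an information-grade no-go in the LINEAR kinematic shadow (critic V20: W1 movement 0): it closes the sketch sub-rung A_z
by name and nothing more — `KinematicShadowSteady`, `PoloidalLiouville` (1222), W1 and NS regularity remain OPEN; no Navier–Stokes
statement is proved here.  `--supports stmt-NavierStokesRegularity-1222 --as helper`.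
-/

noncomputable section

-- the summit and its single sub-problem share the name (CONVENTIONS §1)
set_option linter.dupNamespace false

open Set Function Filter Topology InnerProductSpace
open scoped RealInnerProductSpace Laplacian

namespace Summit.NavierStokesRegularity.NavierStokesRegularity.Theorems.PoloidalLiouville.KinematicShadow

open Literature.Analysis Literature.Analysis.FluidPDE
open Summit.NavierStokesRegularity.NavierStokesRegularity.Theorems.PoloidalLiouville.NetFlux (E3)
open Summit.NavierStokesRegularity.NavierStokesRegularity.Theorems.AveragedConeLiouville.MeridianLaplacian
  (deriv_fst_eq_fderiv deriv_snd_eq_fderiv)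

variable {x₀ e n : E3} {u : E3 → E3} {t : ℝ → ℝ} {f m : E3 → ℝ} {R : ℝ}

/-! ### The transport equation for `W = h · r sin θ · u_θ` -/

/-- ★ **The transport equation**: for `W(r,θ) = t′(cos θ) (r sin θ) u_θ(r,θ)`, `h = t′∘cos`, `L(θ) = ΔZ(x₀ + e_r(θ))`, at every
`(r,θ) ∈ (R,∞) × (0,π)`: `W` is differentiable and `DW(r,θ)·(r h′/h, 1) = −L′(θ)` (from the `θ`-identity and the `r`-derivative of
(†)). [folklore] -/
theorem zonal_transport (hu : ContDiff ℝ 1 u) (hdiv : VectorCalculus.IsDivFree u) (ht : ContDiff ℝ 3 t)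
    (hh : ∀ θ : ℝ, 0 < deriv t (Real.cos θ))
    (hf : f = fun z : E3 => ⟪u z, gradient (fun w : E3 => t (⟪w - x₀, e⟫ / ‖w - x₀‖)) z⟫
      - Δ (fun w : E3 => t (⟪w - x₀, e⟫ / ‖w - x₀‖)) z)
    (hm : m = fun z : E3 => ⟪u z, z - x₀⟫) (he : ‖e‖ = 1) (hn : ‖n‖ = 1) (hen : ⟪e, n⟫ = 0) (hR : 0 ≤ R)
    (hKm : ∀ x : E3, R < ‖x - x₀‖ → ⟪gradient m x, cross e (x - x₀)⟫ = 0)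
    (hKf : ∀ x : E3, R < ‖x - x₀‖ → ⟪gradient f x, cross e (x - x₀)⟫ = 0)
    (hiii : ∀ x : E3, R < ‖x - x₀‖ →
      ‖x - x₀‖ ^ 3 * ⟪gradient f x, gradient (fun w : E3 => ⟪w - x₀, e⟫ / ‖w - x₀‖) x⟫ =
        -deriv t (⟪x - x₀, e⟫ / ‖x - x₀‖) * ((1 - (⟪x - x₀, e⟫ / ‖x - x₀‖) ^ 2) / ‖x - x₀‖) * ⟪gradient m x, x - x₀⟫)
    {r θ : ℝ} (hr : R < r) (hθ : θ ∈ Ioo 0 Real.pi) :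
    DifferentiableAt ℝ (fun p : ℝ × ℝ => deriv t (Real.cos p.2) * (p.1 * Real.sin p.2) *
        ⟪u (x₀ + p.1 • (Real.cos p.2 • e + Real.sin p.2 • n)), Real.cos p.2 • n - Real.sin p.2 • e⟫) (r, θ) ∧
      fderiv ℝ (fun p : ℝ × ℝ => deriv t (Real.cos p.2) * (p.1 * Real.sin p.2) *
          ⟪u (x₀ + p.1 • (Real.cos p.2 • e + Real.sin p.2 • n)), Real.cos p.2 • n - Real.sin p.2 • e⟫) (r, θ)
        (r * deriv (fun ϑ : ℝ => deriv t (Real.cos ϑ)) θ / deriv t (Real.cos θ), 1) =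
      -deriv (fun ϑ : ℝ => Δ (fun w : E3 => t (⟪w - x₀, e⟫ / ‖w - x₀‖)) (x₀ + (Real.cos ϑ • e + Real.sin ϑ • n))) θ := by
  have hr0 : 0 < r := hR.trans_lt hr
  have hud : Differentiable ℝ u := hu.differentiable one_ne_zero
  have ht' : ContDiff ℝ 2 (deriv t) := contDiff_two_deriv_of_contDiff_three ht
  have htd' : Differentiable ℝ (deriv t) := ht'.differentiable (by norm_num)
  have hhfun : ContDiff ℝ 2 (fun ϑ : ℝ => deriv t (Real.cos ϑ)) := ht'.comp Real.contDiff_cos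
  have hhd : HasDerivAt (fun ϑ : ℝ => deriv t (Real.cos ϑ)) (deriv (fun ϑ : ℝ => deriv t (Real.cos ϑ)) θ) θ :=
    (hhfun.differentiable (by norm_num) θ).hasDerivAt
  set W : ℝ × ℝ → ℝ := fun p => deriv t (Real.cos p.2) * (p.1 * Real.sin p.2) *
    ⟪u (x₀ + p.1 • (Real.cos p.2 • e + Real.sin p.2 • n)), Real.cos p.2 • n - Real.sin p.2 • e⟫ with hW
  -- joint differentiability
  have hWd : DifferentiableAt ℝ W (r, θ) := by
    have hc2 : DifferentiableAt ℝ (fun p : ℝ × ℝ => Real.cos p.2) (r, θ) :=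
      (Real.differentiable_cos _).comp _ differentiableAt_snd
    have hs2 : DifferentiableAt ℝ (fun p : ℝ × ℝ => Real.sin p.2) (r, θ) :=
      (Real.differentiable_sin _).comp _ differentiableAt_snd
    have h1 : DifferentiableAt ℝ (fun p : ℝ × ℝ => deriv t (Real.cos p.2)) (r, θ) := (htd' _).comp _ hc2
    have h2 : DifferentiableAt ℝ (fun p : ℝ × ℝ => p.1 * Real.sin p.2) (r, θ) := differentiableAt_fst.mul hs2
    have hv1 : DifferentiableAt ℝ (fun p : ℝ × ℝ => Real.cos p.2 • e + Real.sin p.2 • n) (r, θ) :=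
      (hc2.smul_const e).add (hs2.smul_const n)
    have hv2 : DifferentiableAt ℝ (fun p : ℝ × ℝ => Real.cos p.2 • n - Real.sin p.2 • e) (r, θ) :=
      (hc2.smul_const n).sub (hs2.smul_const e)
    have h3 : DifferentiableAt ℝ (fun p : ℝ × ℝ => x₀ + p.1 • (Real.cos p.2 • e + Real.sin p.2 • n)) (r, θ) :=
      (differentiableAt_fst.smul hv1).const_add x₀
    have h4 : DifferentiableAt ℝ (fun p : ℝ × ℝ => u (x₀ + p.1 • (Real.cos p.2 • e + Real.sin p.2 • n))) (r, θ) :=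
      (hud _).comp _ h3
    exact (h1.mul h2).mul (h4.inner ℝ hv2)
  refine ⟨hWd, ?_⟩
  -- abbreviations
  set s := Real.sin θ with hs
  set c := Real.cos θ with hc
  set hv := deriv t c with hhv
  set h' := deriv (fun ϑ : ℝ => deriv t (Real.cos ϑ)) θ with hh'
  set L' := deriv (fun ϑ : ℝ => Δ (fun w : E3 => t (⟪w - x₀, e⟫ / ‖w - x₀‖)) (x₀ + (Real.cos ϑ • e + Real.sin ϑ • n))) θ
    with hL'
  set X : E3 := x₀ + r • (c • e + s • n) with hX
  set A := ⟪u X, c • e + s • n⟫ with hA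
  set B := ⟪u X, c • n - s • e⟫ with hB
  set Ar := ⟪fderiv ℝ u X (c • e + s • n), c • e + s • n⟫ with hAr
  set Br := ⟪fderiv ℝ u X (c • e + s • n), c • n - s • e⟫ with hBr
  set Sθ := ⟪fderiv ℝ u X (c • n - s • e), c • n - s • e⟫ with hSθ
  have hv0 : hv ≠ 0 := (hh θ).ne'
  -- slice derivatives of `u_r`, `u_θ`
  have dA : HasDerivAt (fun ρ : ℝ => ⟪u (x₀ + ρ • (c • e + s • n)), c • e + s • n⟫) Ar r :=
    hasDerivAt_radial_component x₀ (c • e + s • n) (hud _)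
  have dBr : HasDerivAt (fun ρ : ℝ => ⟪u (x₀ + ρ • (c • e + s • n)), c • n - s • e⟫) Br r := by
    have h := hasDerivAt_inner_field_curve (γ := fun ρ : ℝ => x₀ + ρ • (c • e + s • n)) (w := fun _ => c • n - s • e)
      (hud _) (hasDerivAt_chart_radius x₀ _ r) (hasDerivAt_const r _)
    rw [inner_zero_right, add_zero] at h
    exact h
  have dBθ : HasDerivAt (fun ϑ : ℝ => ⟪u (x₀ + r • (Real.cos ϑ • e + Real.sin ϑ • n)), Real.cos ϑ • n - Real.sin ϑ • e⟫)
      (r * Sθ - A) θ := hasDerivAt_polar_component x₀ e n r (hud _)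
  -- the two partial derivatives of `W`
  have dWr : HasDerivAt (fun ρ : ℝ => W (ρ, θ)) (hv * (1 * s) * B + hv * (r * s) * Br) r :=
    (((hasDerivAt_id' r).mul_const s).const_mul hv).mul dBr
  have dWθ : HasDerivAt (fun ϑ : ℝ => W (r, ϑ))
      ((h' * (r * s) + hv * (r * c)) * B + deriv t (Real.cos θ) * (r * Real.sin θ) * (r * Sθ - A)) θ := by
    have h1 : HasDerivAt (fun ϑ : ℝ => deriv t (Real.cos ϑ) * (r * Real.sin ϑ)) (h' * (r * s) + hv * (r * c)) θ := by
      have := hhd.mul ((Real.hasDerivAt_sin θ).const_mul r)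
      exact this.congr_deriv (by rw [hh', hhv, hs, hc])
    exact h1.mul dBθ
  -- the Fréchet derivative along `(a, 1)`
  have hsplit : ((r * h' / hv, 1) : ℝ × ℝ) = (r * h' / hv) • ((1, 0) : ℝ × ℝ) + ((0, 1) : ℝ × ℝ) := by
    ext <;> simp
  rw [hsplit, map_add, map_smul, smul_eq_mul, ← deriv_fst_eq_fderiv hWd, ← deriv_snd_eq_fderiv hWd, dWr.deriv, dWθ.deriv]
  -- (†) near `r` ⇒ its `r`-derivative vanishes
  have T1 : 1 * s * (hv * A - h' * B) + r * s * (hv * Ar - h' * Br) = 0 := by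
    have d1 : HasDerivAt (fun ρ : ℝ => ρ * s * (hv * ⟪u (x₀ + ρ • (c • e + s • n)), c • e + s • n⟫
        - h' * ⟪u (x₀ + ρ • (c • e + s • n)), c • n - s • e⟫)) (1 * s * (hv * A - h' * B) + r * s * (hv * Ar - h' * Br)) r :=
      ((hasDerivAt_id' r).mul_const s).mul ((dA.const_mul hv).sub (dBr.const_mul h'))
    have hev : (fun ρ : ℝ => ρ * s * (hv * ⟪u (x₀ + ρ • (c • e + s • n)), c • e + s • n⟫
        - h' * ⟪u (x₀ + ρ • (c • e + s • n)), c • n - s • e⟫)) =ᶠ[𝓝 r] fun _ => L' := by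
      filter_upwards [Ioi_mem_nhds hr] with ρ hρ
      rw [hL', zonal_dagger hu hdiv ht hh hf hm he hn hen hR hKm hKf hiii hρ hθ]
    have d0 : HasDerivAt (fun ρ : ℝ => ρ * s * (hv * ⟪u (x₀ + ρ • (c • e + s • n)), c • e + s • n⟫
        - h' * ⟪u (x₀ + ρ • (c • e + s • n)), c • n - s • e⟫)) 0 r :=
      (hasDerivAt_const r L').congr_of_eventuallyEq hev
    exact d1.unique d0
  -- the `θ`-identity at `(r, θ)`
  have TI := zonal_theta_identity hu ht hf hm he hn hen hR hiii hr hθ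
  have haWr : r * h' / hv * (hv * (1 * s) * B + hv * (r * s) * Br) = r * h' * s * (B + r * Br) := by
    field_simp
  linear_combination haWr + TI - r * T1

/-! ### Smallness of `W` at the poles -/

/-- **`W → 0` at the poles, locally uniformly in `r`**: `|W(r,θ)| ≤ (sup|t′|) r₂ (sup‖u‖) sin θ`. [folklore] -/
theorem zonal_boundary_decay (hu : ContDiff ℝ 1 u) (ht : ContDiff ℝ 3 t) (he : ‖e‖ = 1) (hn : ‖n‖ = 1) (hen : ⟪e, n⟫ = 0)
    (hR : 0 ≤ R) (r₁ r₂ : ℝ) (hr₁ : R < r₁) (h₁₂ : r₁ ≤ r₂) (ε : ℝ) (hε : 0 < ε) :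
    ∃ δ > 0, ∀ p ∈ Icc r₁ r₂ ×ˢ (Ioo 0 δ ∪ Ioo (Real.pi - δ) Real.pi),
      |(fun p : ℝ × ℝ => deriv t (Real.cos p.2) * (p.1 * Real.sin p.2) *
          ⟪u (x₀ + p.1 • (Real.cos p.2 • e + Real.sin p.2 • n)), Real.cos p.2 • n - Real.sin p.2 • e⟫) p| ≤ ε := by
  obtain ⟨M, hM⟩ := (isCompact_closedBall x₀ r₂).exists_bound_of_continuousOn (hu.continuous.continuousOn)
  obtain ⟨H, hH⟩ := (isCompact_Icc (a := (-1 : ℝ)) (b := 1)).exists_bound_of_continuousOn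
    ((ht.continuous_deriv (by norm_num)).continuousOn)
  have hM0 : 0 ≤ M := le_trans (norm_nonneg _) (hM x₀ (Metric.mem_closedBall_self (hR.trans (hr₁.le.trans h₁₂))))
  have hH0 : 0 ≤ H := le_trans (norm_nonneg _) (hH 0 (by norm_num))
  have hr₂ : 0 ≤ r₂ := hR.trans (hr₁.le.trans h₁₂)
  refine ⟨ε / (H * r₂ * M + 1), div_pos hε (by positivity), ?_⟩
  rintro ⟨ρ, ϑ⟩ ⟨hρ, hϑ⟩
  simp only [mem_Icc] at hρ
  have hρ0 : 0 ≤ ρ := hR.trans (hr₁.le.trans hρ.1)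
  -- `|sin ϑ| < δ`
  have hsin : |Real.sin ϑ| ≤ ε / (H * r₂ * M + 1) := by
    rcases hϑ with h | h
    · exact (Real.abs_sin_le_abs).trans (by rw [abs_of_pos h.1]; exact h.2.le)
    · rw [← Real.sin_pi_sub]
      refine (Real.abs_sin_le_abs).trans ?_
      rw [abs_of_pos (by linarith [h.2])]
      linarith [h.1]
  -- the three factors
  have h1 : |deriv t (Real.cos ϑ)| ≤ H := by
    have := hH (Real.cos ϑ) ⟨Real.neg_one_le_cos ϑ, Real.cos_le_one ϑ⟩
    rwa [Real.norm_eq_abs] at this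
  have h2 : |ρ * Real.sin ϑ| ≤ r₂ * |Real.sin ϑ| := by
    rw [abs_mul, abs_of_nonneg hρ0]; exact mul_le_mul_of_nonneg_right hρ.2 (abs_nonneg _)
  have h3 : |⟪u (x₀ + ρ • (Real.cos ϑ • e + Real.sin ϑ • n)), Real.cos ϑ • n - Real.sin ϑ • e⟫| ≤ M := by
    refine (abs_real_inner_le_norm _ _).trans ?_
    rw [norm_polarVec' he hn hen, mul_one]
    apply hM
    rw [Metric.mem_closedBall, dist_eq_norm, norm_chart_sub (norm_polarVec he hn hen ϑ) hρ0]
    exact hρ.2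
  simp only
  rw [abs_mul, abs_mul]
  calc |deriv t (Real.cos ϑ)| * |ρ * Real.sin ϑ| *
        |⟪u (x₀ + ρ • (Real.cos ϑ • e + Real.sin ϑ • n)), Real.cos ϑ • n - Real.sin ϑ • e⟫|
      ≤ H * (r₂ * |Real.sin ϑ|) * M := by
        apply mul_le_mul (mul_le_mul h1 h2 (abs_nonneg _) hH0) h3 (abs_nonneg _) (by positivity)
    _ = (H * r₂ * M) * |Real.sin ϑ| := by ring
    _ ≤ (H * r₂ * M) * (ε / (H * r₂ * M + 1)) := mul_le_mul_of_nonneg_left hsin (by positivity)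
    _ ≤ ε := by
        rw [mul_div_assoc']
        rw [div_le_iff₀ (by positivity)]
        nlinarith

/-! ### The zonal sub-rung A_z -/

/-- ★★★ **A_z `KinematicShadow.HomogeneousZonalToroidalNeverSteady` (sketch v1.2 l.94–100, VERBATIM with `SteadyKinematicLawOn`
unfolded)**: for `u ∈ C¹` divergence free, `t ∈ C³` with `t′ > 0` on `(−1,1)` and at `±1`, `‖e‖ = 1`, `R ≥ 0`, the steady kinematic
law `∇(⟪u, ∇Z⟫ − ΔZ) × (x − x₀) = ∇⟪u, x − x₀⟫ × ∇Z` for `Z(x) = t(⟪x − x₀, e⟫/‖x − x₀‖)` cannot hold on `{R < ‖x − x₀‖}`.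
Information-grade no-go in the LINEAR kinematic shadow (critic V20); 1222 / W1 / NS regularity OPEN. [folklore] -/
theorem homogeneousZonalToroidalNeverSteady :
    ∀ (u : E3 → E3) (t : ℝ → ℝ) (x₀ e : E3) (R : ℝ), 0 ≤ R → ‖e‖ = 1 →
      ContDiff ℝ 1 u → VectorCalculus.IsDivFree u → ContDiff ℝ 3 t →
      (∀ c ∈ Set.Ioo (-1 : ℝ) 1, 0 < deriv t c) → 0 < deriv t (-1) → 0 < deriv t 1 →
      (∀ x ∈ {x : E3 | R < ‖x - x₀‖},
        cross (gradient (fun z => ⟪u z, gradient (fun x => t (⟪x - x₀, e⟫ / ‖x - x₀‖)) z⟫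
            - Δ (fun x => t (⟪x - x₀, e⟫ / ‖x - x₀‖)) z) x) (x - x₀) =
          cross (gradient (fun z => ⟪u z, z - x₀⟫) x) (gradient (fun x => t (⟪x - x₀, e⟫ / ‖x - x₀‖)) x)) →
      False := by
  intro u t x₀ e R hR he hu hdiv ht hmono hm1 hp1 hlaw
  -- `t′ > 0` on `[−1, 1]`, hence `h = t′ ∘ cos > 0`
  have hpos : ∀ y ∈ Icc (-1 : ℝ) 1, 0 < deriv t y := by
    intro y hy
    rcases hy.1.eq_or_lt with h | h
    · rw [← h]; exact hm1
    rcases hy.2.eq_or_lt with h' | h'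
    · rw [h']; exact hp1
    exact hmono y ⟨h, h'⟩
  have hh : ∀ θ : ℝ, 0 < deriv t (Real.cos θ) := fun θ => hpos _ ⟨Real.neg_one_le_cos θ, Real.cos_le_one θ⟩
  -- a unit vector `n ⊥ e`
  obtain ⟨n, hn, hen⟩ := Calculus.exists_unit_orthogonal (E := E3) (by rw [finrank_euclideanSpace_fin]; norm_num) e
  -- the head density and the momentum
  set f : E3 → ℝ := fun z => ⟪u z, gradient (fun x => t (⟪x - x₀, e⟫ / ‖x - x₀‖)) z⟫
    - Δ (fun x => t (⟪x - x₀, e⟫ / ‖x - x₀‖)) z with hf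
  set m : E3 → ℝ := fun z => ⟪u z, z - x₀⟫ with hm
  -- the three components of the law on the shell
  have hcomp : ∀ x : E3, R < ‖x - x₀‖ →
      ⟪gradient m x, cross e (x - x₀)⟫ = 0 ∧ ⟪gradient f x, cross e (x - x₀)⟫ = 0 ∧
        ‖x - x₀‖ ^ 3 * ⟪gradient f x, gradient (fun w : E3 => ⟪w - x₀, e⟫ / ‖w - x₀‖) x⟫ =
          -deriv t (⟪x - x₀, e⟫ / ‖x - x₀‖) * ((1 - (⟪x - x₀, e⟫ / ‖x - x₀‖) ^ 2) / ‖x - x₀‖) *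
            ⟪gradient m x, x - x₀⟫ := by
    intro x hx
    have hx0 : x ≠ x₀ := by
      intro h; rw [h, sub_self, norm_zero] at hx; exact absurd hx (not_lt.2 hR)
    have hl := hlaw x hx
    rw [gradient_zonal_eq_smul t hx0 (ht.differentiable (by norm_num) _)] at hl
    obtain ⟨h1, h2, h3⟩ := zonalLaw_components he hx0 hl
    have hc1 := abs_le.1 (abs_zonalCos_le_one x₀ x he)
    have hτ : 0 < deriv t (⟪x - x₀, e⟫ / ‖x - x₀‖) := hpos _ ⟨hc1.1, hc1.2⟩
    exact ⟨(mul_eq_zero.1 h1).resolve_left hτ.ne', h2, h3⟩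
  have hKm : ∀ x : E3, R < ‖x - x₀‖ → ⟪gradient m x, cross e (x - x₀)⟫ = 0 := fun x hx => (hcomp x hx).1
  have hKf : ∀ x : E3, R < ‖x - x₀‖ → ⟪gradient f x, cross e (x - x₀)⟫ = 0 := fun x hx => (hcomp x hx).2.1
  have hiii := fun x (hx : R < ‖x - x₀‖) => (hcomp x hx).2.2
  -- regularity of `h` and `L`
  have ht' : ContDiff ℝ 2 (deriv t) := contDiff_two_deriv_of_contDiff_three ht
  have hhfun : ContDiff ℝ 2 (fun ϑ : ℝ => deriv t (Real.cos ϑ)) := ht'.comp Real.contDiff_cos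
  have hL : ContDiff ℝ 1 (fun ϑ : ℝ => Δ (fun x : E3 => t (⟪x - x₀, e⟫ / ‖x - x₀‖)) (x₀ + (Real.cos ϑ • e + Real.sin ϑ • n))) :=
    contDiff_laplacian_zonal_circle ht he hn hen
  -- the transport no-go
  have key := transport_noGo (R := R)
    (W := fun p : ℝ × ℝ => deriv t (Real.cos p.2) * (p.1 * Real.sin p.2) *
      ⟪u (x₀ + p.1 • (Real.cos p.2 • e + Real.sin p.2 • n)), Real.cos p.2 • n - Real.sin p.2 • e⟫)
    (L := fun ϑ : ℝ => Δ (fun x : E3 => t (⟪x - x₀, e⟫ / ‖x - x₀‖)) (x₀ + (Real.cos ϑ • e + Real.sin ϑ • n)))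
    (h := fun ϑ : ℝ => deriv t (Real.cos ϑ))
    (fun θ _ => hh θ) hhfun.continuous.continuousOn (fun θ _ => hhfun.differentiable (by norm_num) θ)
    hL.continuous.continuousOn (fun θ _ => hL.differentiable one_ne_zero θ)
    (by
      rintro ⟨r, θ⟩ ⟨hr, hθ⟩
      exact zonal_transport hu hdiv ht hh hf hm he hn hen hR hKm hKf hiii hr hθ)
    (fun r₁ r₂ hr₁ h₁₂ ε hε => zonal_boundary_decay hu ht he hn hen hR r₁ r₂ hr₁ h₁₂ ε hε)
  have ht2 : ContDiff ℝ 2 t := ht.of_le (by norm_num)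
  rw [laplacian_zonal_north ht2 he hn hen, laplacian_zonal_south ht2 he hn hen] at key
  linarith

end Summit.NavierStokesRegularity.NavierStokesRegularity.Theorems.PoloidalLiouville.KinematicShadow

end
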